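import Mathlib
import Summits.KontsevichZagierPeriods.KontsevichZagierPeriods.Theorems.HyperbolicBlochZagierDilogarithmConjectureStubGaloisDescent
import Summits.KontsevichZagierPeriods.KontsevichZagierPeriods.Theorems.HyperbolicBlochTetraSector
import HarnessLib

/-!
# `ZagierDilogarithmConjecture` (stmt-KontsevichZagierPeriods-10550) — line
`kummer-clausen-linearisation` (reshape c2, "Galois descent"), stub `stub_galoisSubSector`

**The Galois sub-sector of Kontsevich–Zagier's Conjecture 1 (kernel form, weight 2), route level.** What the
route's deciding theorem `closes` consumes from `hZ = ZagierDilogarithmConjecture` is TetraSector's conclusion: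
for the standard KZ representations `ρ z = [T(z), t⁻³]` on the ideal tetrahedra with algebraic shapes
`zᵢ ∈ ℍ⁺`, `Σ nᵢ · value(ρ zᵢ) = 0 ⇒ Σ nᵢ[ρ zᵢ] ∈ KZ.relations`. This file proves that conclusion on the
largest slice the line can certify — formal combinations `Σ nᵢ[zᵢ]` with zero Dehn invariant whose
Galois-twisted odd volumes `Σ nᵢ (D(σwᵢ) − D(σw'ᵢ))` vanish for every `ℚ`-algebra map `σ : ℚ̄ → ℂ` (at
`σ =` the inclusion this IS the volume relation, `value(ρ zᵢ) = vol T(zᵢ) = D(zᵢ)`) — GIVEN Dupont 2001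
Thm. 10.24 a) (Borel + Suslin), an explicit hypothesis: `stub_galoisDescent` (p122345) puts `Σ nᵢ[zᵢ]` in
`⟨dilogRelators⟩`, and the PROVED five-term transfer theorem `FiveTermTransfer_of` turns every relator into a
KZ relation exactly as in `sectorReduction_proof`. Generalises lead c1's `stub_subSector` (points in a
number field with one complex place). Sorry-free; axioms ⊆ {propext, Classical.choice, Quot.sound}.
-/

noncomputable section

open scoped BigOperators ComplexConjugate
open Literature.NumberTheory.Transcendental
open Summit.KontsevichZagierPeriods.HyperbolicBloch.ZagierDilogarithmConjectureNegative (dehn)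

namespace Summit.KontsevichZagierPeriods.HyperbolicBloch.ZagierDilogarithmGaloisDescent

/-- **The Galois sub-sector of Conjecture 1** (stub `stub_galoisSubSector` of line
`kummer-clausen-linearisation`, reshape c2): for the standard tetrahedral representations `ρ`, a formal
combination of algebraic shapes in `ℍ⁺` with zero Dehn invariant and vanishing Galois-twisted odd volumes
has `Σ nᵢ[ρ zᵢ] ∈ KZ.relations`, GIVEN Dupont 2001 Thm. 10.24 a). [cite: Dupont2001, Thm. 10.24 a)] -/
theorem stub_galoisSubSector :
    Dupont2001_preBloch_relation_of_invariants →
    ∀ (T : ℂ → Set (Fin 3 → ℝ)), (∀ z, T z = {p | 0 < p 1 ∧ z.re * p 1 < z.im * p 0 ∧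
      z.im * (p 0 - 1) < (z.re - 1) * p 1 ∧ 0 < p 2 ∧
      0 < z.im * (p 0 ^ 2 + p 1 ^ 2 + p 2 ^ 2 - p 0) + (z.re - Complex.normSq z) * p 1}) →
    ∀ (ρ : ℂ → KZ.IntegralRep 3), (∀ z, IsAlgebraic ℚ z → 0 < z.im →
      (ρ z).domain = T z ∧ Set.EqOn (ρ z).integrand (fun p => 1 / p 2 ^ 3) (T z)) →
    ∀ (k : ℕ) (z : Fin k → ℂ) (n : Fin k → ℤ), (∀ i, IsAlgebraic ℚ (z i)) → (∀ i, 0 < (z i).im) →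
      (∀ u v : Additive ℂˣ →+ ℚ, dehn u v (∑ i, n i • FreeAbelianGroup.of (z i)) = 0) →
      (∀ (σ : ↥(algebraicClosure ℚ ℂ) →ₐ[ℚ] ℂ) (w w' : Fin k → ↥(algebraicClosure ℚ ℂ)),
          (∀ i, (w i : ℂ) = z i) → (∀ i, (w' i : ℂ) = conj (z i)) →
          ∑ i, (n i : ℝ) * (blochWignerDilog (σ (w i)) - blochWignerDilog (σ (w' i))) = 0) →
        (∑ i, n i • KZ.of (ρ (z i))) ∈ KZ.relations := by
  intro hD T hT ρ hρ k z n halg him hdehn hprop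
  -- (1) Galois descent: the formal combination is explained
  have hmem := stub_galoisDescent hD k z n halg him hdehn hprop
  -- (2) transfer: every relator is a KZ relation (`FiveTermTransfer_of`, as in `sectorReduction_proof`)
  obtain ⟨B, hB⟩ : ∃ B : ℂ → KZ.FormalRep, ∀ w, B w = if 0 < w.im then KZ.of (ρ w)
      else if w.im < 0 then -KZ.of (ρ (conj w)) else 0 := ⟨_, fun _ => rfl⟩
  let φ : FreeAbelianGroup ℂ →+ KZ.FormalRep := FreeAbelianGroup.lift B
  have hφ : ∀ w, φ (FreeAbelianGroup.of w) = B w := fun w => FreeAbelianGroup.lift_apply_of _ _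
  have hle : AddSubgroup.closure dilogRelators ≤ KZ.relations.comap φ := by
    rw [AddSubgroup.closure_le]
    rintro c ((⟨x, y, hx, hy, hx0, hx1, hy0, hy1, hxy, rfl⟩ | ⟨w, -, rfl⟩) | ⟨w, hw, rfl⟩)
    · simp only [SetLike.mem_coe, AddSubgroup.mem_comap, map_add, map_sub, hφ]
      exact FiveTerm.FiveTermTransfer_of T hT ρ hρ B hB x y hx hy hx0 hx1 hy0 hy1 hxy
    · simp only [SetLike.mem_coe, AddSubgroup.mem_comap, map_add, hφ]
      rw [SectorReduction.B_add_B_conj_eq_zero ρ B hB w]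
      exact zero_mem _
    · simp only [SetLike.mem_coe, AddSubgroup.mem_comap, hφ]
      rw [SectorReduction.B_eq_zero_of_im_eq_zero ρ B hB w hw]
      exact zero_mem _
  have hφsum : φ (∑ i, n i • FreeAbelianGroup.of (z i)) = ∑ i, n i • KZ.of (ρ (z i)) := by
    rw [map_sum]
    refine Finset.sum_congr rfl fun i _ => ?_
    rw [map_zsmul, hφ, hB, if_pos (him i)]
  have h2 : (∑ i, n i • FreeAbelianGroup.of (z i)) ∈ KZ.relations.comap φ := hle hmem
  rwa [AddSubgroup.mem_comap, hφsum] at h2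

end Summit.KontsevichZagierPeriods.HyperbolicBloch.ZagierDilogarithmGaloisDescent

end
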